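import Literature.NumberTheory.LFunctions.VinogradovKorobovFarZeros
import Literature.NumberTheory.LFunctions.ZetaZerosProofs
import HarnessLib

/-!
# The far-zero sum above height `t + 1`: Ford's `I₁` with a closed lower edge (Ford 2002, proof of Lemma 4.3)

Topic `Literature/NumberTheory/LFunctions`. Part of the decomposition of **Lemma 4.6 of
Mossinghoff–Trudgian–Yang** (arXiv:2212.06867) = Ford 2002, Lemma 4.3 with (3.8) in place of
Rosser's `N(T)` theorem; hypothesis `h46` of the in-tree assembly of MTY Lemma 4.7. Everything here
is PROVED; no named fact is introduced.

For the zeros `ρ = β + iγ` with `|γ − t| ≥ 1` Ford bounds (proof of Lemma 4.3, (4.5))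
`S₁ ≤ ∫_{t+1}^∞ dN(u)/(u−t)² + ∫_{14}^{t−1} dN(u)/(t−u)² + ∫_{14}^∞ dN(u)/(u+t)² = I₁ + I₂ + I₃`.
The tree has the rigorous finite-set counterparts of `I₂` and `I₃`, and of `I₁` for the zeros with
`γ > t + 1` (`FordFarZeros.lower_tail_sum_le`, `neg_ordinates_sum_le`, `upper_tail_sum_le`,
`VinogradovKorobovFarZeros.lean`, written for (6.4) at `η = ½` with the half-open window
`t − 1 < γ ≤ t + 1`). The general-`η` window bookkeeping (`VinogradovKorobovFarZerosWindow.lean`)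
uses Ford's OPEN window `|γ − t| < 1`, so the zeros with `γ = t + 1` exactly must go into `I₁`;
this file supplies that version, `FarZeros.sum_upper_ordinates_le`: **for a finite set of zeros
with `γ ≥ t + 1` (closed), `Σ m/|1+it−ρ|² ≤ (1/2π)[log((t+1)/2π) + log(t+1)/t] + q(t+1) + q(2t)
+ C_q(3 log 2t + 1)/t²`** from two-sided counting bounds `|N − M| ≤ q` (`q ≥ 0` non-decreasing,
`q ≤ C_q log`), by the layer-cake identity `g(γ) = g(U) + ∫_γ^U (−g')` summed over the zeros
(`sum_layer_cake`, the rigorous partial summation; the partial sums `Σ_{γ<u} m` are bounded by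
`N(u) − N(t + 1 − δ)` and `δ → 0` at the end), an explicit antiderivative for the main term, and
the `q`-integral split at `2t`. `FarZeros.sum_upper_ordinates_le_gen` is the same with the counting
bounds assumed from an arbitrary threshold `1 < T₀ ≤ 100` on (for explicit `N(T)` theorems valid
from `T₀ = 30`, say); `sum_upper_ordinates_le` is its case `T₀ = 14`.

## References

* K. Ford, *Zero-free regions for the Riemann zeta function* (2002) = arXiv:1910.08205, proof of
  Lemma 4.3, (4.4)–(4.5). (`Ford2002Millennium`)
* M. J. Mossinghoff, T. S. Trudgian, A. Yang, arXiv:2212.06867, Lemma 4.6 and (3.8).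
  (`MossinghoffTrudgianYangRNT2024`)
-/

noncomputable section

open Complex Real MeasureTheory Finset Set Filter
open scoped Topology ComplexConjugate

namespace Literature.NumberTheory.LFunctions

namespace FarZeros

open FordFarZeros (rvmMain hasDerivAt_rvmMain continuousOn_rvmMain)

/-! ## Layer cake: `Σ_ρ w(ρ) (g(b) + ∫_{k(ρ)}^b φ) = g(b) Σ w + ∫_a^b φ(u) Σ_{k(ρ)<u} w(ρ) du` -/

/-- `∫_k^b φ = ∫_a^b 1_{(k,∞)} φ` for `a ≤ k ≤ b`. [folklore] -/
theorem integral_indicator_Ioi_eq {φ : ℝ → ℝ} {a k b : ℝ} (hak : a ≤ k) (hkb : k ≤ b)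
    (hφ : IntervalIntegrable φ volume a b) :
    ∫ u in a..b, (Set.Ioi k).indicator φ u = ∫ u in k..b, φ u := by
  have hab : a ≤ b := hak.trans hkb
  have h1 : IntervalIntegrable ((Set.Ioi k).indicator φ) volume a k :=
    ⟨(hφ.mono_set (by rw [Set.uIcc_of_le hab, Set.uIcc_of_le hak]; exact Icc_subset_Icc le_rfl hkb)).1.indicator
      measurableSet_Ioi,
     (hφ.mono_set (by rw [Set.uIcc_of_le hab, Set.uIcc_of_le hak]; exact Icc_subset_Icc le_rfl hkb)).2.indicator
      measurableSet_Ioi⟩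
  have h2 : IntervalIntegrable ((Set.Ioi k).indicator φ) volume k b :=
    ⟨(hφ.mono_set (by rw [Set.uIcc_of_le hab, Set.uIcc_of_le hkb]; exact Icc_subset_Icc hak le_rfl)).1.indicator
      measurableSet_Ioi,
     (hφ.mono_set (by rw [Set.uIcc_of_le hab, Set.uIcc_of_le hkb]; exact Icc_subset_Icc hak le_rfl)).2.indicator
      measurableSet_Ioi⟩
  rw [← intervalIntegral.integral_add_adjacent_intervals h1 h2]
  have e1 : ∫ u in a..k, (Set.Ioi k).indicator φ u = 0 := by
    rw [intervalIntegral.integral_of_le hak, integral_Ioc_eq_integral_Ioo,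
      setIntegral_congr_fun measurableSet_Ioo (g := fun _ ↦ (0 : ℝ)) fun u hu ↦ ?_, integral_zero]
    exact Set.indicator_of_notMem (fun h ↦ absurd (Set.mem_Ioi.1 h) (not_lt.2 hu.2.le)) _
  have e2 : ∫ u in k..b, (Set.Ioi k).indicator φ u = ∫ u in k..b, φ u := by
    rw [intervalIntegral.integral_of_le hkb, intervalIntegral.integral_of_le hkb,
      integral_Ioc_eq_integral_Ioo, integral_Ioc_eq_integral_Ioo]
    exact setIntegral_congr_fun measurableSet_Ioo fun u hu ↦ Set.indicator_of_mem (Set.mem_Ioi.2 hu.1) _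
  rw [e1, e2, zero_add]

/-- Interval integrability of the indicator weights. [folklore] -/
theorem intervalIntegrable_indicator_Ioi {φ : ℝ → ℝ} {a b : ℝ} (hφ : IntervalIntegrable φ volume a b)
    (k : ℝ) : IntervalIntegrable ((Set.Ioi k).indicator φ) volume a b :=
  ⟨hφ.1.indicator measurableSet_Ioi, hφ.2.indicator measurableSet_Ioi⟩

/-- **Layer cake / summation by parts for a finite set**: if `a ≤ k(ρ) ≤ b` on `S` then
`Σ_S w(ρ) (c + ∫_{k(ρ)}^b φ) = c Σ_S w + ∫_a^b φ(u) (Σ_{ρ ∈ S, k(ρ) < u} w(ρ)) du`.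
[cite: Ford2002Millennium, proof of Lemma 4.3 (partial summation)] -/
theorem sum_layer_cake {S : Finset ℂ} {w k : ℂ → ℝ} {φ : ℝ → ℝ} {a b c : ℝ}
    (hk : ∀ ρ ∈ S, a ≤ k ρ ∧ k ρ ≤ b) (hφ : IntervalIntegrable φ volume a b) :
    ∑ ρ ∈ S, w ρ * (c + ∫ u in (k ρ)..b, φ u)
      = c * ∑ ρ ∈ S, w ρ + ∫ u in a..b, φ u * ∑ ρ ∈ S.filter (fun ρ ↦ k ρ < u), w ρ := by
  classical
  have step : ∀ ρ ∈ S, w ρ * (c + ∫ u in (k ρ)..b, φ u)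
      = c * w ρ + ∫ u in a..b, w ρ * (Set.Ioi (k ρ)).indicator φ u := by
    intro ρ hρ
    rw [intervalIntegral.integral_const_mul, integral_indicator_Ioi_eq (hk ρ hρ).1 (hk ρ hρ).2 hφ]
    ring
  rw [Finset.sum_congr rfl step, Finset.sum_add_distrib, ← Finset.mul_sum,
    ← intervalIntegral.integral_finsetSum fun ρ _ ↦ (intervalIntegrable_indicator_Ioi hφ _).const_mul _]
  congr 1
  refine intervalIntegral.integral_congr fun u _ ↦ ?_
  rw [Finset.sum_filter, Finset.mul_sum]
  refine Finset.sum_congr rfl fun ρ _ ↦ ?_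
  by_cases h : k ρ < u
  · rw [Set.indicator_of_mem (Set.mem_Ioi.2 h), if_pos h]; ring
  · rw [Set.indicator_of_notMem (fun h' ↦ h (Set.mem_Ioi.1 h')), if_neg h]; ring

/-! ## Counting: partial sums of multiplicities versus `N(T)` -/

/-- **A finite set of zeros with `T₁ < Im ρ ≤ T₂` has total multiplicity `≤ N(T₂) − N(T₁)`**
(`0 ≤ T₁`). [cite: Titchmarsh1986, §9.1] -/
theorem sum_le_zetaZeroCount_sub {T₁ T₂ : ℝ} (h₁ : 0 ≤ T₁) (h12 : T₁ ≤ T₂) (S : Finset ℂ)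
    (hS : ∀ ρ ∈ S, riemannZeta ρ = 0 ∧ T₁ < ρ.im ∧ ρ.im ≤ T₂) :
    ∑ ρ ∈ S, (riemannZetaZeroOrder ρ : ℝ) ≤ (zetaZeroCount T₂ : ℝ) - zetaZeroCount T₁ := by
  classical
  have hB := zetaZeroBox_finite 0 T₂
  have hA := zetaZeroBox_finite 0 T₁
  have hsub : hA.toFinset ⊆ hB.toFinset := by
    refine Set.Finite.toFinset_subset_toFinset.2 ?_
    rintro ρ ⟨h0, h1, h2, h3, h4⟩
    exact ⟨h0, h1, h2, h3, by linarith⟩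
  rw [SchoenfeldBound.zetaZeroCount_eq_sum, SchoenfeldBound.zetaZeroCount_eq_sum, ← Finset.sum_sdiff hsub,
    add_sub_cancel_right]
  refine Finset.sum_le_sum_of_subset_of_nonneg ?_ ?_
  · intro ρ hρ
    obtain ⟨h0, h3, h4⟩ := hS ρ hρ
    have hne : ρ.im ≠ 0 := by intro h; rw [h] at h3; linarith
    have hs := re_mem_Ioo_of_riemannZeta_eq_zero_of_im_ne_zero h0 hne
    rw [Finset.mem_sdiff, Set.Finite.mem_toFinset, Set.Finite.mem_toFinset]
    refine ⟨⟨h0, hs.1.le, hs.2.le, by linarith, h4⟩, ?_⟩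
    rintro ⟨-, -, -, -, h5⟩
    linarith
  · intro ρ hρ _
    rw [Finset.mem_sdiff, Set.Finite.mem_toFinset] at hρ
    exact_mod_cast riemannZetaZeroOrder_nonneg_of_mem_zetaZeroBox hρ.1

/-- A finite set of zeros with `0 < Im ρ ≤ T` has total multiplicity `≤ N(T)`. [cite: Titchmarsh1986, §9.1] -/
theorem sum_le_zetaZeroCount {T : ℝ} (S : Finset ℂ)
    (hS : ∀ ρ ∈ S, riemannZeta ρ = 0 ∧ 0 < ρ.im ∧ ρ.im ≤ T) :
    ∑ ρ ∈ S, (riemannZetaZeroOrder ρ : ℝ) ≤ (zetaZeroCount T : ℝ) := by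
  rcases le_or_gt 0 T with hT | hT
  · have h := sum_le_zetaZeroCount_sub le_rfl hT S hS
    rwa [zetaZeroCount_eq_zero_of_nonpos le_rfl, Nat.cast_zero, sub_zero] at h
  · have hS0 : S = ∅ := Finset.eq_empty_of_forall_notMem fun ρ hρ ↦ by
      have := hS ρ hρ; linarith [this.2.1, this.2.2]
    rw [hS0, Finset.sum_empty]
    exact Nat.cast_nonneg _

/-- The partial sums `u ↦ φ(u) Σ_{k(ρ)<u} w(ρ)` are interval integrable (finite sums of indicator
weights). [folklore] -/
theorem intervalIntegrable_mul_partialSum {S : Finset ℂ} {w k : ℂ → ℝ} {φ : ℝ → ℝ} {a b : ℝ}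
    (hφ : IntervalIntegrable φ volume a b) :
    IntervalIntegrable (fun u ↦ φ u * ∑ ρ ∈ S.filter (fun ρ ↦ k ρ < u), w ρ) volume a b := by
  classical
  have e : (fun u ↦ φ u * ∑ ρ ∈ S.filter (fun ρ ↦ k ρ < u), w ρ)
      = fun u ↦ ∑ ρ ∈ S, w ρ * (Set.Ioi (k ρ)).indicator φ u := by
    funext u
    rw [Finset.sum_filter, Finset.mul_sum]
    refine Finset.sum_congr rfl fun ρ _ ↦ ?_
    by_cases h : k ρ < u
    · rw [Set.indicator_of_mem (Set.mem_Ioi.2 h), if_pos h]; ring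
    · rw [Set.indicator_of_notMem (fun h' ↦ h (Set.mem_Ioi.1 h')), if_neg h]; ring
  rw [e]
  have h := IntervalIntegrable.sum S fun ρ _ ↦ (intervalIntegrable_indicator_Ioi hφ (k ρ)).const_mul (w ρ)
  have e2 : (∑ ρ ∈ S, fun u ↦ w ρ * (Set.Ioi (k ρ)).indicator φ u)
      = fun u ↦ ∑ ρ ∈ S, w ρ * (Set.Ioi (k ρ)).indicator φ u := by
    funext u; simp only [Finset.sum_apply]
  rwa [e2] at h

/-! ## The weight and its comparison with `1/(γ − t)²` -/

/-- `|1 + it − ρ|² ≥ (t − Im ρ)²`, so `m/|1+it−ρ|² ≤ m/(t − Im ρ)²`. [folklore] -/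
theorem weight_le {t : ℝ} {ρ : ℂ} (hγ : ρ.im ≠ t) {m : ℝ} (hm : 0 ≤ m) :
    m / ‖1 + (t : ℂ) * I - ρ‖ ^ 2 ≤ m / (t - ρ.im) ^ 2 := by
  have him : (1 + (t : ℂ) * I - ρ).im = t - ρ.im := by simp
  have h1 : (t - ρ.im) ^ 2 ≤ ‖1 + (t : ℂ) * I - ρ‖ ^ 2 := by
    rw [← him, sq_le_sq, abs_norm]
    exact Complex.abs_im_le_norm _
  have h0 : 0 < (t - ρ.im) ^ 2 := by
    have : t - ρ.im ≠ 0 := sub_ne_zero.2 (Ne.symm hγ)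
    positivity
  exact div_le_div_of_nonneg_left hm h0 h1

/-- `∫_k^b 2/(c+u)³ du = 1/(c+k)² − 1/(c+b)²` when `c + u > 0` on `[k, b]`. [folklore] -/
theorem integral_two_div_add_cube {c k b : ℝ} (hk : 0 < c + k) (hkb : k ≤ b) :
    ∫ u in k..b, 2 / (c + u) ^ 3 = 1 / (c + k) ^ 2 - 1 / (c + b) ^ 2 := by
  have hderiv : ∀ x ∈ uIcc k b, HasDerivAt (fun u : ℝ ↦ -(1 / (c + u) ^ 2)) (2 / (c + x) ^ 3) x := by
    intro x hx
    rw [Set.uIcc_of_le hkb, Set.mem_Icc] at hx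
    have hx0 : c + x ≠ 0 := by linarith
    have h1 : HasDerivAt (fun u : ℝ ↦ (c + u) ^ 2) (2 * (c + x)) x := by
      simpa using ((hasDerivAt_id' x).const_add c).fun_pow 2
    have h := (h1.fun_inv (pow_ne_zero 2 hx0)).fun_neg
    have e : (fun u : ℝ ↦ -(1 / (c + u) ^ 2)) = fun u ↦ -((c + u) ^ 2)⁻¹ := by funext u; rw [one_div]
    rw [e]
    refine h.congr_deriv ?_
    field_simp
  have hcont : ContinuousOn (fun x : ℝ ↦ 2 / (c + x) ^ 3) (uIcc k b) := by
    refine continuousOn_const.div ((continuousOn_const.add continuousOn_id).pow 3) fun x hx ↦ ?_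
    rw [Set.uIcc_of_le hkb, Set.mem_Icc] at hx
    exact pow_ne_zero 3 (by linarith)
  rw [intervalIntegral.integral_eq_sub_of_hasDerivAt hderiv (hcont.intervalIntegrable)]
  ring

/-- Continuity of `u ↦ 2/(c+u)³` on an interval where `c + u > 0`. [folklore] -/
theorem continuousOn_two_div_add_cube {c k b : ℝ} (hk : 0 < c + k) (hkb : k ≤ b) :
    ContinuousOn (fun x : ℝ ↦ 2 / (c + x) ^ 3) (uIcc k b) := by
  refine continuousOn_const.div ((continuousOn_const.add continuousOn_id).pow 3) fun x hx ↦ ?_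
  rw [Set.uIcc_of_le hkb, Set.mem_Icc] at hx
  exact pow_ne_zero 3 (by linarith)

/-! ## Increments of the main term `M(T) = (T/2π) log(T/2πe)` (`FordFarZeros.rvmMain`) -/

/-- `log(T/(2πe)) = log(T/2π) − 1`. [folklore] -/
theorem log_div_two_pi_e {T : ℝ} (hT : 0 < T) :
    Real.log (T / (2 * π * Real.exp 1)) = Real.log (T / (2 * π)) - 1 := by
  rw [show T / (2 * π * Real.exp 1) = T / (2 * π) / Real.exp 1 by ring,
    Real.log_div (by positivity) (Real.exp_ne_zero 1), Real.log_exp]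

/-- The one-step increment bound `M(T) − M(s) ≤ (T − s) M'(T)` for `0 < s ≤ T` (from
`log(T/s) ≤ T/s − 1`). [folklore] -/
theorem rvmMain_sub_le {s T : ℝ} (hs : 0 < s) (hsT : s ≤ T) :
    rvmMain T - rvmMain s ≤ (T - s) * (1 / (2 * π) * Real.log (T / (2 * π))) := by
  have hT : 0 < T := hs.trans_le hsT
  unfold rvmMain
  rw [log_div_two_pi_e hT, log_div_two_pi_e hs, Real.log_div hT.ne' (by positivity),
    Real.log_div hs.ne' (by positivity)]
  have hlog : Real.log T - Real.log s ≤ T / s - 1 := by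
    rw [← Real.log_div hT.ne' hs.ne']
    exact Real.log_le_sub_one_of_pos (by positivity)
  have hkey : s * (Real.log T - Real.log s) ≤ T - s := by
    have := mul_le_mul_of_nonneg_left hlog hs.le
    rwa [show s * (T / s - 1) = T - s by field_simp] at this
  have hπ : 0 < 2 * π := by positivity
  rw [show T / (2 * π) * (Real.log T - Real.log (2 * π) - 1) - s / (2 * π) * (Real.log s - Real.log (2 * π) - 1)
      = ((T - s) * (Real.log T - Real.log (2 * π) - 1) + s * (Real.log T - Real.log s)) / (2 * π) by
        field_simp; ring,
    show (T - s) * (1 / (2 * π) * (Real.log T - Real.log (2 * π)))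
      = ((T - s) * (Real.log T - Real.log (2 * π) - 1) + (T - s)) / (2 * π) by field_simp; ring]
  exact div_le_div_of_nonneg_right (by linarith) hπ.le

/-! ## Zeros with `Im ρ ≥ t + 1`: `I₁` -/

/-- `∫_a^b log u/u³ du = [−(2 log u + 1)/(4u²)]_a^b` (`0 < a ≤ b`). [folklore] -/
theorem integral_log_div_cube {a b : ℝ} (ha : 0 < a) (hab : a ≤ b) :
    ∫ u in a..b, Real.log u / u ^ 3
      = -(2 * Real.log b + 1) / (4 * b ^ 2) + (2 * Real.log a + 1) / (4 * a ^ 2) := by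
  have hderiv : ∀ x ∈ uIcc a b,
      HasDerivAt (fun u : ℝ ↦ -(2 * Real.log u + 1) / (4 * u ^ 2)) (Real.log x / x ^ 3) x := by
    intro x hx
    rw [Set.uIcc_of_le hab, Set.mem_Icc] at hx
    have hx0 : x ≠ 0 := by linarith
    have h1 : HasDerivAt (fun u : ℝ ↦ -(2 * Real.log u + 1)) (-(2 * x⁻¹)) x :=
      (((Real.hasDerivAt_log hx0).const_mul 2).add_const 1).fun_neg
    have h2 : HasDerivAt (fun u : ℝ ↦ 4 * u ^ 2) (4 * (2 * x)) x := by
      simpa using (hasDerivAt_pow 2 x).const_mul 4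
    refine (h1.fun_div h2 (by positivity)).congr_deriv ?_
    field_simp
    ring
  have hcont : ContinuousOn (fun x : ℝ ↦ Real.log x / x ^ 3) (uIcc a b) := by
    refine ContinuousOn.div (Real.continuousOn_log.mono ?_) (continuousOn_pow 3) ?_
    · intro x hx; rw [Set.uIcc_of_le hab, Set.mem_Icc] at hx
      simp only [Set.mem_compl_iff, Set.mem_singleton_iff]; linarith
    · intro x hx; rw [Set.uIcc_of_le hab, Set.mem_Icc] at hx; exact pow_ne_zero 3 (by linarith)
  rw [intervalIntegral.integral_eq_sub_of_hasDerivAt hderiv hcont.intervalIntegrable]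
  ring

/-- `log U/U² ≤ log X/X²` for `e ≤ X ≤ U`. [folklore] -/
theorem log_div_sq_le {X U : ℝ} (hX : Real.exp 1 ≤ X) (hXU : X ≤ U) :
    Real.log U / U ^ 2 ≤ Real.log X / X ^ 2 := by
  have hX0 : 0 < X := (Real.exp_pos 1).trans_le hX
  have hU0 : 0 < U := hX0.trans_le hXU
  have h1 : Real.log U / U ≤ Real.log X / X :=
    Real.log_div_self_antitoneOn (Set.mem_Ici.2 hX) (Set.mem_Ici.2 (hX.trans hXU)) hXU
  have h2 : 1 / U ≤ 1 / X := one_div_le_one_div_of_le hX0 hXU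
  have hlU : 0 ≤ Real.log U / U := div_nonneg (Real.log_nonneg (by linarith [Real.add_one_le_exp (1 : ℝ)])) hU0.le
  have := mul_le_mul h1 h2 (by positivity) (div_nonneg (Real.log_nonneg (by linarith [Real.add_one_le_exp (1 : ℝ)])) hX0.le)
  rw [show Real.log U / U ^ 2 = Real.log U / U * (1 / U) by field_simp,
    show Real.log X / X ^ 2 = Real.log X / X * (1 / X) by field_simp]
  exact this

set_option maxHeartbeats 1600000 in
/-- **Ford's `I₁`** for a finite set of zeros with `Im ρ ≥ t + 1` (`t ≥ 100`):
`Σ m/|1+it−ρ|² ≤ (1/2π)[log((t+1)/2π) + log(t+1)/t] + q(t+1) + q(2t) + C_q (3 log 2t + 1)/t²`,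
given two-sided counting bounds `M(T) − q(T) ≤ N(T) ≤ M(T) + q(T)` (`T ≥ T₀`, any threshold
`1 < T₀ ≤ 100`) with `q ≥ 0`
non-decreasing and `q(T) ≤ C_q log T` (Ford: "`I₁ ≤ (1/2π)[(1+1/t)log(1+t) − log 2π] + |Q(t+1)|
+ 2∫_1^∞ |Q(t+x)|x⁻³ dx`"; here the integral of `q` is split at `2t`, costing `q(2t) − q(t)`).
[cite: Ford2002Millennium, proof of Lemma 4.3 (I₁)] -/
theorem sum_upper_ordinates_le_gen {t : ℝ} (ht : 100 ≤ t) {T₀ : ℝ} (hT₀ : 1 < T₀) (hT₀t : T₀ ≤ 100)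
    {q : ℝ → ℝ} {Cq : ℝ}
    (hq₁ : ∀ T : ℝ, T₀ ≤ T → (zetaZeroCount T : ℝ) ≤ rvmMain T + q T)
    (hq₂ : ∀ T : ℝ, T₀ ≤ T → rvmMain T - q T ≤ zetaZeroCount T)
    (hqm : MonotoneOn q (Set.Ici T₀)) (hq0 : 0 ≤ q T₀) (hqg : ∀ T : ℝ, T₀ ≤ T → q T ≤ Cq * Real.log T)
    (S : Finset ℂ) (hS : ∀ ρ ∈ S, riemannZeta ρ = 0 ∧ t + 1 ≤ ρ.im) :
    ∑ ρ ∈ S, (riemannZetaZeroOrder ρ : ℝ) / ‖1 + (t : ℂ) * I - ρ‖ ^ 2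
      ≤ 1 / (2 * π) * (Real.log ((t + 1) / (2 * π)) + Real.log (t + 1) / t)
        + q (t + 1) + q (2 * t) + Cq * (3 * Real.log (2 * t) + 1) / t ^ 2 := by
  classical
  set m : ℂ → ℝ := fun ρ ↦ (riemannZetaZeroOrder ρ : ℝ) with hm
  set k : ℂ → ℝ := fun ρ ↦ ρ.im with hk
  set M₁ := rvmMain (t + 1) with hM₁
  set D := 1 / (2 * π) * Real.log ((t + 1) / (2 * π)) with hD
  have hm0 : ∀ ρ ∈ S, 0 ≤ m ρ := fun ρ hρ ↦ by
    have h : (0 : ℤ) ≤ riemannZetaZeroOrder ρ :=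
      riemannZetaZeroOrder_nonneg fun h1 ↦ riemannZeta_one_ne_zero (h1 ▸ (hS ρ hρ).1)
    simp only [hm]; exact_mod_cast h
  have hCq : 0 ≤ Cq := by
    have h := (hq0.trans (hqg T₀ le_rfl))
    have hl : 0 < Real.log T₀ := Real.log_pos hT₀
    nlinarith
  have hD0 : 0 ≤ D := by
    have : 1 ≤ (t + 1) / (2 * π) := by rw [le_div_iff₀ (by positivity)]; nlinarith [Real.pi_lt_d2]
    have := Real.log_nonneg this
    positivity
  have hq_mono : ∀ a b : ℝ, T₀ ≤ a → a ≤ b → q a ≤ q b := fun a b ha hab ↦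
    hqm (Set.mem_Ici.2 ha) (Set.mem_Ici.2 (ha.trans hab)) hab
  have hq_nn : ∀ a : ℝ, T₀ ≤ a → 0 ≤ q a := fun a ha ↦ hq0.trans (hq_mono T₀ a le_rfl ha)
  -- the truncation height `U ≥ 2t`, above every ordinate
  set U : ℝ := 2 * t + 1 + ∑ ρ ∈ S, (k ρ - t) with hU
  have hkt : ∀ ρ ∈ S, 0 ≤ k ρ - t := fun ρ hρ ↦ by have := (hS ρ hρ).2; rw [hk]; simp only; linarith
  have hU2t : 2 * t + 1 ≤ U := by have := Finset.sum_nonneg hkt; linarith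
  have hkU : ∀ ρ ∈ S, k ρ + 1 ≤ U := fun ρ hρ ↦ by
    have := Finset.single_le_sum hkt hρ; linarith
  -- step 1: weights and layer cake
  have step1 : ∑ ρ ∈ S, m ρ / ‖1 + (t : ℂ) * I - ρ‖ ^ 2
      ≤ ∑ ρ ∈ S, m ρ * (1 / (-t + U) ^ 2 + ∫ u in (k ρ)..U, 2 / (-t + u) ^ 3) := by
    refine Finset.sum_le_sum fun ρ hρ ↦ ?_
    have hγ := (hS ρ hρ).2
    refine (weight_le (by linarith) (hm0 ρ hρ)).trans (le_of_eq ?_)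
    rw [integral_two_div_add_cube (by rw [hk]; simp only; linarith) (by linarith [hkU ρ hρ]), div_eq_mul_one_div]
    congr 1
    rw [hk]; ring_nf
  have hab : t + 1 ≤ U := by linarith
  have hφ : IntervalIntegrable (fun u : ℝ ↦ 2 / (-t + u) ^ 3) volume (t + 1) U :=
    (continuousOn_two_div_add_cube (by linarith) hab).intervalIntegrable
  rw [sum_layer_cake (fun ρ hρ ↦ ⟨(hS ρ hρ).2, by linarith [hkU ρ hρ]⟩) hφ] at step1
  have hintφ : ∫ u in (t + 1)..U, 2 / (-t + u) ^ 3 = 1 - 1 / (-t + U) ^ 2 := by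
    rw [integral_two_div_add_cube (by linarith) hab]; ring_nf
  -- step 2: the counts, for a small `δ > 0`
  have hcount : ∀ δ : ℝ, 0 < δ → δ ≤ 1 → ∀ u : ℝ, t + 1 ≤ u →
      ∑ ρ ∈ S.filter (fun ρ ↦ k ρ < u), m ρ ≤ rvmMain u - M₁ + δ * D + q u + q (t + 1) := by
    intro δ hδ hδ1 u hu
    have h := sum_le_zetaZeroCount_sub (T₁ := t + 1 - δ) (T₂ := u) (by linarith) (by linarith)
      (S.filter fun ρ ↦ k ρ < u) fun ρ hρ ↦ ?_
    · have hupper := hq₁ u (by linarith)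
      have hlower := hq₂ (t + 1 - δ) (by linarith)
      have hMδ : M₁ - rvmMain (t + 1 - δ) ≤ δ * D := by
        have := rvmMain_sub_le (s := t + 1 - δ) (T := t + 1) (by linarith) (by linarith)
        rw [hM₁, hD]
        have e : t + 1 - (t + 1 - δ) = δ := by ring
        rwa [e] at this
      have hqδ : q (t + 1 - δ) ≤ q (t + 1) := hq_mono _ _ (by linarith) (by linarith)
      linarith
    · rw [Finset.mem_filter] at hρ
      have h1 := (hS ρ hρ.1).2
      have h2 : k ρ < u := hρ.2
      exact ⟨(hS ρ hρ.1).1, by linarith, le_of_lt h2⟩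
  have htotal : ∀ δ : ℝ, 0 < δ → δ ≤ 1 →
      ∑ ρ ∈ S, m ρ ≤ rvmMain U - M₁ + δ * D + q U + q (t + 1) := by
    intro δ hδ hδ1
    have h := hcount δ hδ hδ1 U hab
    rwa [Finset.filter_true_of_mem fun ρ hρ ↦ (by linarith [hkU ρ hρ] : k ρ < U)] at h
  -- step 3: the antiderivative of `2/(u−t)³ (M(u) − M(t+1))`
  set H : ℝ → ℝ := fun u ↦ -((rvmMain u - M₁) / (u - t) ^ 2)
    + 1 / (2 * π) * (-(Real.log (u / (2 * π)) / (u - t)) + 1 / t * (Real.log (u - t) - Real.log u)) with hH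
  have hHderiv : ∀ u ∈ uIcc (t + 1) U, HasDerivAt H (2 / (-t + u) ^ 3 * (rvmMain u - M₁)) u := by
    intro u hu
    rw [Set.uIcc_of_le hab, Set.mem_Icc] at hu
    have hu0 : 0 < u := by linarith
    have hut : u - t ≠ 0 := by linarith
    have hut' : -t + u ≠ 0 := by linarith
    have hM := hasDerivAt_rvmMain hu0
    have hd : HasDerivAt (fun x : ℝ ↦ x - t) (1 - 0) u := (hasDerivAt_id' u).fun_sub (hasDerivAt_const u t)
    have hd2 := hd.fun_pow 2
    norm_num at hd2
    have d1 := ((hM.fun_sub (hasDerivAt_const u M₁)).fun_div hd2 (pow_ne_zero 2 hut)).fun_neg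
    have hl : HasDerivAt (fun x : ℝ ↦ Real.log (x / (2 * π))) (1 / (2 * π) / (u / (2 * π))) u := by
      simpa using ((hasDerivAt_id' u).div_const (2 * π)).log (by positivity)
    have d2 := (hl.fun_div hd hut).fun_neg
    have d3 := (hd.log hut).fun_sub (Real.hasDerivAt_log hu0.ne')
    have d := d1.fun_add ((d2.fun_add (d3.const_mul (1 / t))).const_mul (1 / (2 * π)))
    have e : H = fun x ↦ -((rvmMain x - M₁) / (x - t) ^ 2)
        + 1 / (2 * π) * (-(Real.log (x / (2 * π)) / (x - t)) + 1 / t * (Real.log (x - t) - Real.log x)) := rfl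
    rw [e]
    refine d.congr_deriv ?_
    field_simp
    ring
  have hcontM : ContinuousOn (fun u : ℝ ↦ 2 / (-t + u) ^ 3 * (rvmMain u - M₁)) (uIcc (t + 1) U) := by
    refine (continuousOn_two_div_add_cube (by linarith) hab).mul
      ((continuousOn_rvmMain.mono ?_).sub continuousOn_const)
    intro x hx
    rw [Set.uIcc_of_le hab, Set.mem_Icc] at hx
    exact Set.mem_Ioi.2 (by linarith)
  have hmain : ∫ u in (t + 1)..U, 2 / (-t + u) ^ 3 * (rvmMain u - M₁) = H U - H (t + 1) :=
    intervalIntegral.integral_eq_sub_of_hasDerivAt hHderiv hcontM.intervalIntegrable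
  have hHval : H U - H (t + 1) + 1 / (-t + U) ^ 2 * (rvmMain U - M₁)
      ≤ 1 / (2 * π) * (Real.log ((t + 1) / (2 * π)) + Real.log (t + 1) / t) := by
    have hπ : 0 < 2 * π := by positivity
    have e1 : H (t + 1) = 0 + 1 / (2 * π) * (-(Real.log ((t + 1) / (2 * π)) / 1)
        + 1 / t * (Real.log 1 - Real.log (t + 1))) := by
      simp only [hH, hM₁]
      rw [show t + 1 - t = (1 : ℝ) by ring]
      simp
    have e2 : H U = -((rvmMain U - M₁) / (U - t) ^ 2)
        + 1 / (2 * π) * (-(Real.log (U / (2 * π)) / (U - t)) + 1 / t * (Real.log (U - t) - Real.log U)) := rfl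
    rw [e1, e2, Real.log_one, show -t + U = U - t by ring]
    have h1 : 0 ≤ Real.log (U / (2 * π)) / (U - t) := by
      refine div_nonneg (Real.log_nonneg ?_) (by linarith)
      rw [le_div_iff₀ hπ]; nlinarith [Real.pi_lt_d2]
    have h2 : Real.log (U - t) - Real.log U ≤ 0 := by
      rw [sub_nonpos]; exact Real.log_le_log (by linarith) (by linarith)
    have h3 : 1 / (2 * π) * (-(Real.log (U / (2 * π)) / (U - t)) + 1 / t * (Real.log (U - t) - Real.log U)) ≤ 0 := by
      have : 1 / t * (Real.log (U - t) - Real.log U) ≤ 0 :=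
        mul_nonpos_of_nonneg_of_nonpos (by positivity) h2
      have : -(Real.log (U / (2 * π)) / (U - t)) + 1 / t * (Real.log (U - t) - Real.log U) ≤ 0 := by linarith
      exact mul_nonpos_of_nonneg_of_nonpos (by positivity) this
    have e3 : -((rvmMain U - M₁) / (U - t) ^ 2) + 1 / (U - t) ^ 2 * (rvmMain U - M₁) = 0 := by ring
    have e4 : 0 + 1 / (2 * π) * (-(Real.log ((t + 1) / (2 * π)) / 1) + 1 / t * (0 - Real.log (t + 1)))
        = -(1 / (2 * π) * (Real.log ((t + 1) / (2 * π)) + Real.log (t + 1) / t)) := by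
      field_simp; ring
    linarith [e3, e4]
  -- step 4: the `q`-integrals
  have h2t14 : T₀ ≤ 2 * t := by linarith
  have hqint : ∫ u in (t + 1)..U, 2 / (-t + u) ^ 3 * q u ≤ q (2 * t) + Cq * (2 * Real.log (2 * t) + 1) / t ^ 2 := by
    have hqi : ∀ a b : ℝ, t + 1 ≤ a → a ≤ b → IntervalIntegrable (fun u ↦ 2 / (-t + u) ^ 3 * q u) volume a b := by
      intro a b ha hab'
      have hmono : MonotoneOn q (uIcc a b) := by
        rw [Set.uIcc_of_le hab']
        exact hqm.mono fun x hx ↦ Set.mem_Ici.2 (by linarith [hx.1])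
      exact hmono.intervalIntegrable.continuousOn_mul (continuousOn_two_div_add_cube (by linarith) hab')
    have h2tU : 2 * t ≤ U := by linarith
    rw [← intervalIntegral.integral_add_adjacent_intervals (hqi (t + 1) (2 * t) le_rfl (by linarith))
      (hqi (2 * t) U (by linarith) h2tU)]
    -- on `[t+1, 2t]`: `q(u) ≤ q(2t)`
    have hA : ∫ u in (t + 1)..(2 * t), 2 / (-t + u) ^ 3 * q u ≤ q (2 * t) := by
      have h1 : ∫ u in (t + 1)..(2 * t), 2 / (-t + u) ^ 3 * q u
          ≤ ∫ u in (t + 1)..(2 * t), 2 / (-t + u) ^ 3 * q (2 * t) := by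
        refine intervalIntegral.integral_mono_on (by linarith) (hqi _ _ le_rfl (by linarith))
          ((continuousOn_two_div_add_cube (by linarith) (by linarith)).intervalIntegrable.mul_const _)
          fun u hu ↦ ?_
        rw [Set.mem_Icc] at hu
        exact mul_le_mul_of_nonneg_left (hq_mono u (2 * t) (by linarith) hu.2)
          (div_nonneg (by norm_num) (pow_nonneg (by linarith) 3))
      rw [intervalIntegral.integral_mul_const, integral_two_div_add_cube (by linarith) (by linarith)] at h1
      have h2 : (1 / (-t + (t + 1)) ^ 2 - 1 / (-t + 2 * t) ^ 2) * q (2 * t) ≤ q (2 * t) := by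
        have hq2 := hq_nn (2 * t) h2t14
        have h0 : 0 ≤ 1 / (-t + 2 * t) ^ 2 := by positivity
        have h1 : 1 / (-t + (t + 1)) ^ 2 = 1 := by rw [show -t + (t + 1) = (1 : ℝ) by ring]; norm_num
        rw [h1]
        nlinarith
      linarith
    -- on `[2t, U]`: `2/(u−t)³ ≤ 16/u³` and `q(u) ≤ C_q log u`
    have hB : ∫ u in (2 * t)..U, 2 / (-t + u) ^ 3 * q u ≤ Cq * (2 * Real.log (2 * t) + 1) / t ^ 2 := by
      have hcont16 : ContinuousOn (fun u : ℝ ↦ 16 * Cq * (Real.log u / u ^ 3)) (uIcc (2 * t) U) := by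
        refine continuousOn_const.mul (ContinuousOn.div (Real.continuousOn_log.mono ?_) (continuousOn_pow 3) ?_)
        · intro x hx; rw [Set.uIcc_of_le h2tU, Set.mem_Icc] at hx
          simp only [Set.mem_compl_iff, Set.mem_singleton_iff]; linarith
        · intro x hx; rw [Set.uIcc_of_le h2tU, Set.mem_Icc] at hx; exact pow_ne_zero 3 (by linarith)
      have h1 : ∫ u in (2 * t)..U, 2 / (-t + u) ^ 3 * q u ≤ ∫ u in (2 * t)..U, 16 * Cq * (Real.log u / u ^ 3) := by
        refine intervalIntegral.integral_mono_on h2tU (hqi _ _ (by linarith) h2tU) hcont16.intervalIntegrable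
          fun u hu ↦ ?_
        rw [Set.mem_Icc] at hu
        have hu0 : 0 < u := by linarith
        have hw : 2 / (-t + u) ^ 3 ≤ 16 / u ^ 3 := by
          rw [div_le_div_iff₀ (pow_pos (by linarith) 3) (pow_pos hu0 3)]
          have h8 : u ^ 3 ≤ 8 * (-t + u) ^ 3 := by
            have : u ≤ 2 * (-t + u) := by linarith
            have h0 : 0 ≤ u := hu0.le
            calc u ^ 3 ≤ (2 * (-t + u)) ^ 3 := pow_le_pow_left₀ h0 this 3
              _ = 8 * (-t + u) ^ 3 := by ring
          nlinarith
        have hqu : q u ≤ Cq * Real.log u := hqg u (by linarith)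
        have hlog : 0 ≤ Real.log u := Real.log_nonneg (by linarith)
        calc 2 / (-t + u) ^ 3 * q u ≤ 16 / u ^ 3 * (Cq * Real.log u) :=
              mul_le_mul hw hqu (hq_nn u (by linarith)) (by positivity)
          _ = 16 * Cq * (Real.log u / u ^ 3) := by ring
      rw [intervalIntegral.integral_const_mul, integral_log_div_cube (by linarith) h2tU] at h1
      refine h1.trans ?_
      have hU0 : 0 < U := by linarith
      have hneg : -(2 * Real.log U + 1) / (4 * U ^ 2) ≤ 0 := by
        have : 0 ≤ Real.log U := Real.log_nonneg (by linarith)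
        exact div_nonpos_of_nonpos_of_nonneg (by linarith) (by positivity)
      have e : 16 * Cq * ((2 * Real.log (2 * t) + 1) / (4 * (2 * t) ^ 2)) = Cq * (2 * Real.log (2 * t) + 1) / t ^ 2 := by
        field_simp; ring
      nlinarith [hneg, hCq, e]
    linarith
  have hqbd : 1 / (-t + U) ^ 2 * q U ≤ Cq * Real.log (2 * t) / t ^ 2 := by
    have hU0 : 0 < U := by linarith
    have h1 : 1 / (-t + U) ^ 2 ≤ 4 / U ^ 2 := by
      rw [div_le_div_iff₀ (pow_pos (by linarith) 2) (pow_pos hU0 2)]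
      nlinarith
    have h2 : q U ≤ Cq * Real.log U := hqg U (by linarith)
    have h3 : Real.log U / U ^ 2 ≤ Real.log (2 * t) / (2 * t) ^ 2 :=
      log_div_sq_le (by linarith [Real.exp_one_lt_d9]) (by linarith)
    calc 1 / (-t + U) ^ 2 * q U ≤ 4 / U ^ 2 * (Cq * Real.log U) :=
          mul_le_mul h1 h2 (hq_nn U (by linarith)) (by positivity)
      _ = 4 * Cq * (Real.log U / U ^ 2) := by ring
      _ ≤ 4 * Cq * (Real.log (2 * t) / (2 * t) ^ 2) := mul_le_mul_of_nonneg_left h3 (by positivity)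
      _ = Cq * Real.log (2 * t) / t ^ 2 := by field_simp; ring
  -- step 5: integrate the pointwise count bound, for each `δ`
  have hint1 := intervalIntegrable_mul_partialSum (S := S) (w := m) (k := k) hφ
  have hkey : ∀ δ : ℝ, 0 < δ → δ ≤ 1 →
      ∑ ρ ∈ S, m ρ / ‖1 + (t : ℂ) * I - ρ‖ ^ 2
        ≤ 1 / (2 * π) * (Real.log ((t + 1) / (2 * π)) + Real.log (t + 1) / t)
          + q (t + 1) + q (2 * t) + Cq * (3 * Real.log (2 * t) + 1) / t ^ 2 + δ * D := by
    intro δ hδ hδ1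
    set B : ℝ → ℝ := fun u ↦ rvmMain u - M₁ + δ * D + q u + q (t + 1) with hB
    have hiB : IntervalIntegrable (fun u ↦ 2 / (-t + u) ^ 3 * B u) volume (t + 1) U := by
      have hmono : MonotoneOn q (uIcc (t + 1) U) := by
        rw [Set.uIcc_of_le hab]
        exact hqm.mono fun x hx ↦ Set.mem_Ici.2 (by linarith [hx.1])
      have hq_int : IntervalIntegrable (fun u ↦ 2 / (-t + u) ^ 3 * q u) volume (t + 1) U :=
        hmono.intervalIntegrable.continuousOn_mul (continuousOn_two_div_add_cube (by linarith) hab)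
      have e : (fun u ↦ 2 / (-t + u) ^ 3 * B u)
          = fun u ↦ 2 / (-t + u) ^ 3 * (rvmMain u - M₁) + 2 / (-t + u) ^ 3 * (δ * D + q (t + 1))
            + 2 / (-t + u) ^ 3 * q u := by
        funext u; simp only [hB]; ring
      rw [e]
      exact (hcontM.intervalIntegrable.add (hφ.mul_const _)).add hq_int
    have hmono : ∫ u in (t + 1)..U, 2 / (-t + u) ^ 3 * ∑ ρ ∈ S.filter (fun ρ ↦ k ρ < u), m ρ
        ≤ ∫ u in (t + 1)..U, 2 / (-t + u) ^ 3 * B u := by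
      refine intervalIntegral.integral_mono_on hab hint1 hiB fun u hu ↦ ?_
      rw [Set.mem_Icc] at hu
      exact mul_le_mul_of_nonneg_left (hcount δ hδ hδ1 u hu.1)
        (div_nonneg (by norm_num) (pow_nonneg (by linarith) 3))
    have hsplit : ∫ u in (t + 1)..U, 2 / (-t + u) ^ 3 * B u
        = (H U - H (t + 1)) + (δ * D + q (t + 1)) * (1 - 1 / (-t + U) ^ 2)
          + ∫ u in (t + 1)..U, 2 / (-t + u) ^ 3 * q u := by
      have hmono' : MonotoneOn q (uIcc (t + 1) U) := by
        rw [Set.uIcc_of_le hab]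
        exact hqm.mono fun x hx ↦ Set.mem_Ici.2 (by linarith [hx.1])
      have hq_int : IntervalIntegrable (fun u ↦ 2 / (-t + u) ^ 3 * q u) volume (t + 1) U :=
        hmono'.intervalIntegrable.continuousOn_mul (continuousOn_two_div_add_cube (by linarith) hab)
      have e : (fun u ↦ 2 / (-t + u) ^ 3 * B u)
          = fun u ↦ (2 / (-t + u) ^ 3 * (rvmMain u - M₁) + 2 / (-t + u) ^ 3 * (δ * D + q (t + 1)))
            + 2 / (-t + u) ^ 3 * q u := by
        funext u; simp only [hB]; ring
      rw [e, intervalIntegral.integral_add (hcontM.intervalIntegrable.add (hφ.mul_const _)) hq_int,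
        intervalIntegral.integral_add hcontM.intervalIntegrable (hφ.mul_const _), hmain,
        intervalIntegral.integral_mul_const, hintφ]
      ring
    have hbd : 1 / (-t + U) ^ 2 * ∑ ρ ∈ S, m ρ
        ≤ 1 / (-t + U) ^ 2 * (rvmMain U - M₁ + δ * D + q U + q (t + 1)) :=
      mul_le_mul_of_nonneg_left (htotal δ hδ hδ1) (by positivity)
    have hc0 : 0 ≤ 1 / (-t + U) ^ 2 := by positivity
    have e : 1 / (-t + U) ^ 2 * (rvmMain U - M₁ + δ * D + q U + q (t + 1))
        + ((H U - H (t + 1)) + (δ * D + q (t + 1)) * (1 - 1 / (-t + U) ^ 2)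
          + ∫ u in (t + 1)..U, 2 / (-t + u) ^ 3 * q u)
        = (H U - H (t + 1) + 1 / (-t + U) ^ 2 * (rvmMain U - M₁)) + (δ * D + q (t + 1))
          + (1 / (-t + U) ^ 2 * q U + ∫ u in (t + 1)..U, 2 / (-t + u) ^ 3 * q u) := by ring
    have hlog2t : Cq * (2 * Real.log (2 * t) + 1) / t ^ 2 + Cq * Real.log (2 * t) / t ^ 2
        = Cq * (3 * Real.log (2 * t) + 1) / t ^ 2 := by field_simp; ring
    linarith [step1, hmono, hsplit, hbd, e, hHval, hqint, hqbd, hlog2t]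
  -- step 6: let `δ → 0`
  refine le_of_forall_pos_le_add fun ε hε ↦ ?_
  have hδ : 0 < min 1 (ε / (D + 1)) := lt_min one_pos (div_pos hε (by linarith))
  have h := hkey (min 1 (ε / (D + 1))) hδ (min_le_left _ _)
  have hδD : min 1 (ε / (D + 1)) * D ≤ ε := by
    have h1 : min 1 (ε / (D + 1)) * D ≤ ε / (D + 1) * D :=
      mul_le_mul_of_nonneg_right (min_le_right _ _) hD0
    have h2 : ε / (D + 1) * D ≤ ε := by
      rw [div_mul_eq_mul_div, div_le_iff₀ (by linarith)]; nlinarith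
    linarith
  linarith

/-- **Ford's `I₁`** with the counting bounds assumed from `T ≥ 14` on (the original interface of
this file; the case `T₀ = 14` of `sum_upper_ordinates_le_gen`).
[cite: Ford2002Millennium, proof of Lemma 4.3 (I₁)] -/
theorem sum_upper_ordinates_le {t : ℝ} (ht : 100 ≤ t) {q : ℝ → ℝ} {Cq : ℝ}
    (hq₁ : ∀ T : ℝ, 14 ≤ T → (zetaZeroCount T : ℝ) ≤ rvmMain T + q T)
    (hq₂ : ∀ T : ℝ, 14 ≤ T → rvmMain T - q T ≤ zetaZeroCount T)
    (hqm : MonotoneOn q (Set.Ici 14)) (hq0 : 0 ≤ q 14) (hqg : ∀ T : ℝ, 14 ≤ T → q T ≤ Cq * Real.log T)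
    (S : Finset ℂ) (hS : ∀ ρ ∈ S, riemannZeta ρ = 0 ∧ t + 1 ≤ ρ.im) :
    ∑ ρ ∈ S, (riemannZetaZeroOrder ρ : ℝ) / ‖1 + (t : ℂ) * I - ρ‖ ^ 2
      ≤ 1 / (2 * π) * (Real.log ((t + 1) / (2 * π)) + Real.log (t + 1) / t)
        + q (t + 1) + q (2 * t) + Cq * (3 * Real.log (2 * t) + 1) / t ^ 2 :=
  sum_upper_ordinates_le_gen ht (by norm_num) (by norm_num) hq₁ hq₂ hqm hq0 hqg S hS

end FarZeros

end Literature.NumberTheory.LFunctions
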